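import Summits.NavierStokesRegularity.NavierStokesRegularity.Theorems.EfficiencyFloorLerayFloorGapAttainmentTransfer
import Summits.NavierStokesRegularity.NavierStokesRegularity.Theorems.TypeILiouvilleTypeIliouvilleNoTypeIINormalForm
import HarnessLib

/-!
# Route `EfficiencyFloor`, bet node `NearMaximiserBoundedAmplification` (stmt-25483) / `RigidExit` (stmt-25513) on the
# `ProductionEfficiencyDecay` ladder (stmt-22866): THE PAIR `(A, ε)` IS VISCOSITY-FREE — reduction to `ν = 1`

Helper file (`--supports stmt-NavierStokesRegularity-22866`; line `efficiency_floor`). The route decl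
`Theses.EfficiencyFloor.NearMaximiserBoundedAmplification` asks for ONE pair `(A, ε)` serving every viscosity `ν > 0`; the item text of
`RigidExit` books this uniformity as «uniformly in `ν` by the scaling `u ↦ νu(ν·, ν²·)`». This file PROVES that clause: the
viscosity normalisation `v(s, x) = ν⁻¹ u(s/ν, x)`, `π(s, x) = ν⁻² p(s/ν, x)` (Tao 2013, footnote 3) maps the route class at `(ν, T)`
onto the route class at `(1, νT)` (tree: `TypeIliouvilleNoTypeII.EternalSplit.isMaximalSmoothSolution_timeRescale_one`), slices to
`ν⁻¹`-multiples (`Z ↦ ν⁻²Z`, `Pal ↦ ν⁻²Pal`), normalised maximisers at `ν` to normalised maximisers at `1`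
(`LerayFloorGap.Attainment.normalisedMaximiser_const_smul`), preserves the scale-free `ε`-closeness, and maps the would-be blow-up
window `(64ν³/(27c⁴))·Z(u s)⁻²` after `s` onto the window `(64/(27c⁴))·Z(v(νs))⁻²` after `νs`.

* `integral_curl_sq_const_smul`, `integral_frobeniusNormSq_fderiv_curl_const_smul` (§1): `Z(a·w) = a²Z(w)`, `Pal(a·w) = a²Pal(w)`.
* `boundedAmplification_of_unitViscosity` (§2): for any constant `c` and any pair `(A, ε)`, bounded amplification near normalised
  maximisers for the route class AT VISCOSITY `1` implies the same, with the SAME `(A, ε)`, at every viscosity `ν > 0`.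
* `nearMaximiserBoundedAmplification_iff_unitViscosity` (§3, BY NAME): the route decl is EQUIVALENT to its `ν = 1` instance.

READING: item (ii) of `RigidExit` (one margin uniform over all `ε`-close slices) may be proved at `ν = 1` only. HONEST FRAMING:
scaling bookkeeping between OPEN statements about a HYPOTHETICAL blow-up; `NearMaximiserBoundedAmplification`, `RigidExit`,
`LerayFloorGap`, `ProductionEfficiencyDecay` (stmt-22866) and Navier–Stokes regularity stay OPEN; no summit statement is proved.
[folklore]
-/

-- the problem directory repeats the summit name (`NavierStokesRegularity/NavierStokesRegularity`)
set_option linter.dupNamespace false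

noncomputable section

open Set Filter MeasureTheory Topology Function
open scoped InnerProductSpace RealInnerProductSpace ENNReal NNReal ContDiff
open Literature.Analysis.FluidPDE

namespace Summit.NavierStokesRegularity.NavierStokesRegularity.Theorems

namespace NearMaximiserBoundedAmplification

open LerayFloorGap.Attainment TypeIliouvilleNoTypeII.EternalSplit

/-! ## §1 Enstrophy and palinstrophy of a scalar multiple -/

/-- `Z(a·w) = a²·Z(w)` for a differentiable field. [folklore] -/
theorem integral_curl_sq_const_smul {w : EuclideanSpace ℝ (Fin 3) → EuclideanSpace ℝ (Fin 3)} (hw : Differentiable ℝ w)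
    (a : ℝ) : (∫ x, ‖curl (fun y => a • w y) x‖ ^ 2) = a ^ 2 * ∫ x, ‖curl w x‖ ^ 2 := by
  rw [curl_const_smul_eq hw a, ← integral_const_mul]
  refine integral_congr_ae (Eventually.of_forall fun x => ?_)
  simp only [norm_smul, mul_pow, Real.norm_eq_abs, sq_abs]

/-- `Pal(a·w) = a²·Pal(w)` for a `C²` field. [folklore] -/
theorem integral_frobeniusNormSq_fderiv_curl_const_smul {w : EuclideanSpace ℝ (Fin 3) → EuclideanSpace ℝ (Fin 3)}
    (hw : ContDiff ℝ 2 w) (a : ℝ) :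
    (∫ x, frobeniusNormSq (fderiv ℝ (curl fun y => a • w y) x)) = a ^ 2 * ∫ x, frobeniusNormSq (fderiv ℝ (curl w) x) := by
  rw [← integral_const_mul]
  refine integral_congr_ae (Eventually.of_forall fun x => ?_)
  simp only [fderiv_curl_const_smul hw a x, frobeniusNormSq_const_smul]

/-! ## §2 Bounded amplification near maximisers: viscosity `1` ⟹ every viscosity, same `(A, ε)` -/

/-- **Bounded amplification near normalised maximisers transfers from viscosity `1` to every `ν > 0` with the same pair
`(A, ε)`** (viscosity normalisation `v(s,x) = ν⁻¹u(s/ν,x)` of the route class; amplitude scaling of maximisers; scale-free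
closeness; the would-be blow-up windows correspond). [cite: Tao2011, footnote 3] -/
theorem boundedAmplification_of_unitViscosity (c A ε : ℝ)
    (h1 :
      ∀ T : ℝ, 0 < T → ∀ (u : ℝ → EuclideanSpace ℝ (Fin 3) → EuclideanSpace ℝ (Fin 3)) (p : ℝ → EuclideanSpace ℝ (Fin
      3) → ℝ), Literature.Analysis.FluidPDE.IsMaximalSmoothSolution 1 0 u p T →
      Literature.Analysis.FluidPDE.IsLerayHopfOn T 1 0 (u 0) u → Literature.Analysis.FluidPDE.HasRapidSpatialDecay (u
      0) → ∀ s ∈ Set.Ioo 0 T, ∀ m : EuclideanSpace ℝ (Fin 3) → EuclideanSpace ℝ (Fin 3), ((ContDiff ℝ (⊤ : ℕ∞) m ∧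
      Literature.Analysis.FluidPDE.VectorCalculus.IsDivFree m ∧ (∫⁻ x, ‖iteratedFDeriv ℝ 0 m x‖ₑ ^ 2 < ⊤) ∧ (∫⁻ x,
      ‖iteratedFDeriv ℝ 1 m x‖ₑ ^ 2 < ⊤) ∧ (∫⁻ x, ‖iteratedFDeriv ℝ 2 m x‖ₑ ^ 2 < ⊤)) ∧ 0 < (∫ x,
      ‖Literature.Analysis.FluidPDE.curl m x‖ ^ 2) ∧ (∫ x, ⟪Literature.Analysis.FluidPDE.curl m x, fderiv ℝ m x
      (Literature.Analysis.FluidPDE.curl m x)⟫_ℝ) = c * (∫ x, ‖Literature.Analysis.FluidPDE.curl m x‖ ^ 2) ^ (3 / 4 :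
      ℝ) * (∫ x, Literature.Analysis.FluidPDE.frobeniusNormSq (fderiv ℝ (Literature.Analysis.FluidPDE.curl m) x)) ^ (3
      / 4 : ℝ) ∧ (∫ x, Literature.Analysis.FluidPDE.frobeniusNormSq (fderiv ℝ (Literature.Analysis.FluidPDE.curl m)
      x)) = 81 * c ^ 4 / (256 * 1 ^ 4) * (∫ x, ‖Literature.Analysis.FluidPDE.curl m x‖ ^ 2) ^ 3) → ((∫ x,
      ‖Literature.Analysis.FluidPDE.curl (u s - m) x‖ ^ 2) ≤ ε ^ 2 * (∫ x, ‖Literature.Analysis.FluidPDE.curl (u s) x‖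
      ^ 2) ∧ (∫ x, Literature.Analysis.FluidPDE.frobeniusNormSq (fderiv ℝ (Literature.Analysis.FluidPDE.curl (u s -
      m)) x)) ≤ ε ^ 2 * (∫ x, Literature.Analysis.FluidPDE.frobeniusNormSq (fderiv ℝ
      (Literature.Analysis.FluidPDE.curl (u s)) x))) → ∀ t ∈ Set.Ico s T, t - s ≤ 64 * 1 ^ 3 / (27 * c ^ 4) * (∫ x,
      ‖Literature.Analysis.FluidPDE.curl (u s) x‖ ^ 2)⁻¹ ^ 2 → (∫ x, ‖Literature.Analysis.FluidPDE.curl (u t) x‖ ^ 2)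
      ≤ A * (∫ x, ‖Literature.Analysis.FluidPDE.curl (u s) x‖ ^ 2)) :
    ∀ ν : ℝ, 0 < ν →
      ∀ T : ℝ, 0 < T → ∀ (u : ℝ → EuclideanSpace ℝ (Fin 3) → EuclideanSpace ℝ (Fin 3)) (p : ℝ → EuclideanSpace ℝ (Fin
      3) → ℝ), Literature.Analysis.FluidPDE.IsMaximalSmoothSolution ν 0 u p T →
      Literature.Analysis.FluidPDE.IsLerayHopfOn T ν 0 (u 0) u → Literature.Analysis.FluidPDE.HasRapidSpatialDecay (u
      0) → ∀ s ∈ Set.Ioo 0 T, ∀ m : EuclideanSpace ℝ (Fin 3) → EuclideanSpace ℝ (Fin 3), ((ContDiff ℝ (⊤ : ℕ∞) m ∧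
      Literature.Analysis.FluidPDE.VectorCalculus.IsDivFree m ∧ (∫⁻ x, ‖iteratedFDeriv ℝ 0 m x‖ₑ ^ 2 < ⊤) ∧ (∫⁻ x,
      ‖iteratedFDeriv ℝ 1 m x‖ₑ ^ 2 < ⊤) ∧ (∫⁻ x, ‖iteratedFDeriv ℝ 2 m x‖ₑ ^ 2 < ⊤)) ∧ 0 < (∫ x,
      ‖Literature.Analysis.FluidPDE.curl m x‖ ^ 2) ∧ (∫ x, ⟪Literature.Analysis.FluidPDE.curl m x, fderiv ℝ m x
      (Literature.Analysis.FluidPDE.curl m x)⟫_ℝ) = c * (∫ x, ‖Literature.Analysis.FluidPDE.curl m x‖ ^ 2) ^ (3 / 4 :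
      ℝ) * (∫ x, Literature.Analysis.FluidPDE.frobeniusNormSq (fderiv ℝ (Literature.Analysis.FluidPDE.curl m) x)) ^ (3
      / 4 : ℝ) ∧ (∫ x, Literature.Analysis.FluidPDE.frobeniusNormSq (fderiv ℝ (Literature.Analysis.FluidPDE.curl m)
      x)) = 81 * c ^ 4 / (256 * ν ^ 4) * (∫ x, ‖Literature.Analysis.FluidPDE.curl m x‖ ^ 2) ^ 3) → ((∫ x,
      ‖Literature.Analysis.FluidPDE.curl (u s - m) x‖ ^ 2) ≤ ε ^ 2 * (∫ x, ‖Literature.Analysis.FluidPDE.curl (u s) x‖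
      ^ 2) ∧ (∫ x, Literature.Analysis.FluidPDE.frobeniusNormSq (fderiv ℝ (Literature.Analysis.FluidPDE.curl (u s -
      m)) x)) ≤ ε ^ 2 * (∫ x, Literature.Analysis.FluidPDE.frobeniusNormSq (fderiv ℝ
      (Literature.Analysis.FluidPDE.curl (u s)) x))) → ∀ t ∈ Set.Ico s T, t - s ≤ 64 * ν ^ 3 / (27 * c ^ 4) * (∫ x,
      ‖Literature.Analysis.FluidPDE.curl (u s) x‖ ^ 2)⁻¹ ^ 2 → (∫ x, ‖Literature.Analysis.FluidPDE.curl (u t) x‖ ^ 2)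
      ≤ A * (∫ x, ‖Literature.Analysis.FluidPDE.curl (u s) x‖ ^ 2) := by
  intro ν hν T hT u p hmax hLH hdec s hs m hm hclose t ht hwin
  have hν0 : ν ≠ 0 := hν.ne'
  have hνi : 0 < ν⁻¹ := inv_pos.2 hν
  -- the viscosity-normalised flow at `(1, νT)`
  obtain ⟨hmaxv, hLHv, hdecv⟩ := isMaximalSmoothSolution_timeRescale_one hν hT hmax hLH hdec
  set v : ℝ → EuclideanSpace ℝ (Fin 3) → EuclideanSpace ℝ (Fin 3) := timeRescale ν⁻¹ ν⁻¹ u with hv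
  have hslice : ∀ σ, v (ν * σ) = fun x => ν⁻¹ • u σ x := by
    intro σ
    funext x
    rw [hv, timeRescale_apply, ← mul_assoc, inv_mul_cancel₀ hν0, one_mul]
  -- smoothness of the slices involved
  have hus : ContDiff ℝ (⊤ : ℕ∞) (u s) := hmax.1.contDiff_velocity ⟨hs.1.le, hs.2⟩
  have hut : ContDiff ℝ (⊤ : ℕ∞) (u t) := hmax.1.contDiff_velocity ⟨hs.1.le.trans ht.1, ht.2⟩
  have hmc : ContDiff ℝ (⊤ : ℕ∞) m := hm.1.1
  have husd : Differentiable ℝ (u s) := hus.differentiable (by simp)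
  have hutd : Differentiable ℝ (u t) := hut.differentiable (by simp)
  have husm : Differentiable ℝ (u s - m) := husd.sub (hmc.differentiable (by simp))
  have husm2 : ContDiff ℝ 2 (u s - m) := (hus.sub hmc).of_le (by norm_cast)
  have hus2 : ContDiff ℝ 2 (u s) := hus.of_le (by norm_cast)
  -- enstrophies and palinstrophies of the rescaled slices
  have hZs : (∫ x, ‖curl (v (ν * s)) x‖ ^ 2) = ν⁻¹ ^ 2 * ∫ x, ‖curl (u s) x‖ ^ 2 := by
    rw [hslice]; exact integral_curl_sq_const_smul husd ν⁻¹
  have hZt : (∫ x, ‖curl (v (ν * t)) x‖ ^ 2) = ν⁻¹ ^ 2 * ∫ x, ‖curl (u t) x‖ ^ 2 := by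
    rw [hslice]; exact integral_curl_sq_const_smul hutd ν⁻¹
  have hPs : (∫ x, frobeniusNormSq (fderiv ℝ (curl (v (ν * s))) x)) =
      ν⁻¹ ^ 2 * ∫ x, frobeniusNormSq (fderiv ℝ (curl (u s)) x) := by
    rw [hslice]; exact integral_frobeniusNormSq_fderiv_curl_const_smul hus2 ν⁻¹
  -- the rescaled maximiser
  set m' : EuclideanSpace ℝ (Fin 3) → EuclideanSpace ℝ (Fin 3) := fun y => (1 / ν) • m y with hm'
  have hm'NM := normalisedMaximiser_const_smul (c := c) hν one_pos hm
  have hdiff : v (ν * s) - m' = fun x => ν⁻¹ • (u s - m) x := by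
    funext x
    rw [Pi.sub_apply, hslice, hm', one_div, Pi.sub_apply, smul_sub]
  have hZd : (∫ x, ‖curl (v (ν * s) - m') x‖ ^ 2) = ν⁻¹ ^ 2 * ∫ x, ‖curl (u s - m) x‖ ^ 2 := by
    rw [hdiff]; exact integral_curl_sq_const_smul husm ν⁻¹
  have hPd : (∫ x, frobeniusNormSq (fderiv ℝ (curl (v (ν * s) - m')) x)) =
      ν⁻¹ ^ 2 * ∫ x, frobeniusNormSq (fderiv ℝ (curl (u s - m)) x) := by
    rw [hdiff]; exact integral_frobeniusNormSq_fderiv_curl_const_smul husm2 ν⁻¹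
  have hν2 : 0 < ν⁻¹ ^ 2 := pow_pos hνi 2
  -- closeness is scale free
  have hclose' : (∫ x, ‖curl (v (ν * s) - m') x‖ ^ 2) ≤ ε ^ 2 * (∫ x, ‖curl (v (ν * s)) x‖ ^ 2) ∧
      (∫ x, frobeniusNormSq (fderiv ℝ (curl (v (ν * s) - m')) x)) ≤
        ε ^ 2 * (∫ x, frobeniusNormSq (fderiv ℝ (curl (v (ν * s))) x)) := by
    refine ⟨?_, ?_⟩
    · rw [hZd, hZs, mul_left_comm]
      exact mul_le_mul_of_nonneg_left hclose.1 hν2.le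
    · rw [hPd, hPs, mul_left_comm]
      exact mul_le_mul_of_nonneg_left hclose.2 hν2.le
  -- times and the window
  have hs' : ν * s ∈ Ioo 0 (ν * T) := ⟨mul_pos hν hs.1, mul_lt_mul_of_pos_left hs.2 hν⟩
  have ht' : ν * t ∈ Ico (ν * s) (ν * T) := ⟨mul_le_mul_of_nonneg_left ht.1 hν.le, mul_lt_mul_of_pos_left ht.2 hν⟩
  have hwin' : ν * t - ν * s ≤ 64 * 1 ^ 3 / (27 * c ^ 4) * (∫ x, ‖curl (v (ν * s)) x‖ ^ 2)⁻¹ ^ 2 := by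
    rw [hZs, ← mul_sub]
    have e : 64 * 1 ^ 3 / (27 * c ^ 4) * (ν⁻¹ ^ 2 * ∫ x, ‖curl (u s) x‖ ^ 2)⁻¹ ^ 2 =
        ν * (64 * ν ^ 3 / (27 * c ^ 4) * (∫ x, ‖curl (u s) x‖ ^ 2)⁻¹ ^ 2) := by
      simp only [inv_pow, mul_inv, inv_inv, mul_pow]
      ring
    rw [e]
    exact mul_le_mul_of_nonneg_left hwin hν.le
  -- apply the unit-viscosity statement and scale back
  have key := h1 (ν * T) (mul_pos hν hT) v (timeRescale ν⁻¹ (ν⁻¹ ^ 2) p) hmaxv hLHv hdecv (ν * s) hs' m' hm'NM hclose'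
    (ν * t) ht' hwin'
  rw [hZt, hZs, mul_left_comm] at key
  exact le_of_mul_le_mul_left key hν2

/-! ## §3 BY NAME: the route decl is equivalent to its unit-viscosity instance -/

/-- **`NearMaximiserBoundedAmplification ⟺ its `ν = 1` instance**, BY NAME against the route decl. [cite: Tao2011, footnote 3] -/
theorem nearMaximiserBoundedAmplification_iff_unitViscosity :
    Summit.NavierStokesRegularity.NavierStokesRegularity.Theses.EfficiencyFloor.NearMaximiserBoundedAmplification ↔
      ∀ c : ℝ, (0 < c ∧ (∀ v : EuclideanSpace ℝ (Fin 3) → EuclideanSpace ℝ (Fin 3), (ContDiff ℝ (⊤ : ℕ∞) v ∧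
      Literature.Analysis.FluidPDE.VectorCalculus.IsDivFree v ∧ (∫⁻ x, ‖iteratedFDeriv ℝ 0 v x‖ₑ ^ 2 < ⊤) ∧ (∫⁻ x,
      ‖iteratedFDeriv ℝ 1 v x‖ₑ ^ 2 < ⊤) ∧ (∫⁻ x, ‖iteratedFDeriv ℝ 2 v x‖ₑ ^ 2 < ⊤)) → (∫ x,
      ⟪Literature.Analysis.FluidPDE.curl v x, fderiv ℝ v x (Literature.Analysis.FluidPDE.curl v x)⟫_ℝ) ≤ c * (∫ x,
      ‖Literature.Analysis.FluidPDE.curl v x‖ ^ 2) ^ (3 / 4 : ℝ) * (∫ x, Literature.Analysis.FluidPDE.frobeniusNormSq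
      (fderiv ℝ (Literature.Analysis.FluidPDE.curl v) x)) ^ (3 / 4 : ℝ)) ∧ ∀ c' : ℝ, (∀ w : EuclideanSpace ℝ (Fin 3) →
      EuclideanSpace ℝ (Fin 3), (ContDiff ℝ (⊤ : ℕ∞) w ∧ Literature.Analysis.FluidPDE.VectorCalculus.IsDivFree w ∧ (∫⁻
      x, ‖iteratedFDeriv ℝ 0 w x‖ₑ ^ 2 < ⊤) ∧ (∫⁻ x, ‖iteratedFDeriv ℝ 1 w x‖ₑ ^ 2 < ⊤) ∧ (∫⁻ x, ‖iteratedFDeriv ℝ 2 w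
      x‖ₑ ^ 2 < ⊤)) → (∫ x, ⟪Literature.Analysis.FluidPDE.curl w x, fderiv ℝ w x (Literature.Analysis.FluidPDE.curl w
      x)⟫_ℝ) ≤ c' * (∫ x, ‖Literature.Analysis.FluidPDE.curl w x‖ ^ 2) ^ (3 / 4 : ℝ) * (∫ x,
      Literature.Analysis.FluidPDE.frobeniusNormSq (fderiv ℝ (Literature.Analysis.FluidPDE.curl w) x)) ^ (3 / 4 : ℝ))
      → c ≤ c') → ∃ A ε : ℝ, 1 ≤ A ∧ 0 < ε ∧ ∀ T : ℝ, 0 < T → ∀ (u : ℝ → EuclideanSpace ℝ (Fin 3) → EuclideanSpace ℝ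
      (Fin 3)) (p : ℝ → EuclideanSpace ℝ (Fin 3) → ℝ), Literature.Analysis.FluidPDE.IsMaximalSmoothSolution 1 0 u p T
      → Literature.Analysis.FluidPDE.IsLerayHopfOn T 1 0 (u 0) u → Literature.Analysis.FluidPDE.HasRapidSpatialDecay
      (u 0) → ∀ s ∈ Set.Ioo 0 T, ∀ m : EuclideanSpace ℝ (Fin 3) → EuclideanSpace ℝ (Fin 3), ((ContDiff ℝ (⊤ : ℕ∞) m ∧
      Literature.Analysis.FluidPDE.VectorCalculus.IsDivFree m ∧ (∫⁻ x, ‖iteratedFDeriv ℝ 0 m x‖ₑ ^ 2 < ⊤) ∧ (∫⁻ x,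
      ‖iteratedFDeriv ℝ 1 m x‖ₑ ^ 2 < ⊤) ∧ (∫⁻ x, ‖iteratedFDeriv ℝ 2 m x‖ₑ ^ 2 < ⊤)) ∧ 0 < (∫ x,
      ‖Literature.Analysis.FluidPDE.curl m x‖ ^ 2) ∧ (∫ x, ⟪Literature.Analysis.FluidPDE.curl m x, fderiv ℝ m x
      (Literature.Analysis.FluidPDE.curl m x)⟫_ℝ) = c * (∫ x, ‖Literature.Analysis.FluidPDE.curl m x‖ ^ 2) ^ (3 / 4 :
      ℝ) * (∫ x, Literature.Analysis.FluidPDE.frobeniusNormSq (fderiv ℝ (Literature.Analysis.FluidPDE.curl m) x)) ^ (3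
      / 4 : ℝ) ∧ (∫ x, Literature.Analysis.FluidPDE.frobeniusNormSq (fderiv ℝ (Literature.Analysis.FluidPDE.curl m)
      x)) = 81 * c ^ 4 / (256 * 1 ^ 4) * (∫ x, ‖Literature.Analysis.FluidPDE.curl m x‖ ^ 2) ^ 3) → ((∫ x,
      ‖Literature.Analysis.FluidPDE.curl (u s - m) x‖ ^ 2) ≤ ε ^ 2 * (∫ x, ‖Literature.Analysis.FluidPDE.curl (u s) x‖
      ^ 2) ∧ (∫ x, Literature.Analysis.FluidPDE.frobeniusNormSq (fderiv ℝ (Literature.Analysis.FluidPDE.curl (u s -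
      m)) x)) ≤ ε ^ 2 * (∫ x, Literature.Analysis.FluidPDE.frobeniusNormSq (fderiv ℝ
      (Literature.Analysis.FluidPDE.curl (u s)) x))) → ∀ t ∈ Set.Ico s T, t - s ≤ 64 * 1 ^ 3 / (27 * c ^ 4) * (∫ x,
      ‖Literature.Analysis.FluidPDE.curl (u s) x‖ ^ 2)⁻¹ ^ 2 → (∫ x, ‖Literature.Analysis.FluidPDE.curl (u t) x‖ ^ 2)
      ≤ A * (∫ x, ‖Literature.Analysis.FluidPDE.curl (u s) x‖ ^ 2) := by
  constructor
  · intro h c hc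
    obtain ⟨A, ε, hA, hε, hBA⟩ := h c hc
    exact ⟨A, ε, hA, hε, fun T hT => hBA 1 T one_pos hT⟩
  · intro h c hc
    obtain ⟨A, ε, hA, hε, hBA⟩ := h c hc
    exact ⟨A, ε, hA, hε, fun ν T hν hT => boundedAmplification_of_unitViscosity c A ε hBA ν hν T hT⟩

end NearMaximiserBoundedAmplification

end Summit.NavierStokesRegularity.NavierStokesRegularity.Theorems

end
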